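import Mathlib.Data.Finset.Card
import Mathlib.Data.Finset.SDiff
import Mathlib.Data.Fintype.Basic
import Mathlib.Data.Fintype.Pi
import Mathlib.Data.Fintype.BigOperators
import Mathlib.Data.Nat.Factorial.Basic
import Mathlib.Data.List.OfFn
import Mathlib.Data.Set.Function
import Mathlib.Logic.Function.Basic
import Mathlib.Algebra.BigOperators.Group.Finset.Basic
import Mathlib.Algebra.BigOperators.Ring.Finset
import Mathlib.Algebra.Order.BigOperators.Group.Finset
import Mathlib.Algebra.Group.Action.Defs
import Mathlib.Tactic.Ring
import HarnessLib

/-!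
# Counting colourings that properly colour a set but none of its "petals" (Alon–Boppana 1987, Lemma 3.6)

The probabilistic lemma behind the negative test graphs of Razborov's clique lower bound, in
the form of Alon and Boppana (*The monotone circuit complexity of Boolean functions*,
Combinatorica 7 (1987), Lemma 3.6), stated and PROVED as an inequality between cardinalities
(denominators cleared). A *colouring* is a map `O : V → Fin g`; a vertex set `W` is *properly
coloured* (PC) by `O` iff `O` is injective on `W` (`Set.InjOn O ↑W`).

* `Razborov.fiber O₀ D` — the colourings agreeing with `O₀` off `D`; `card_fiber_le`
  (`≤ g ^ |D|`); `Razborov.goodExt O₀ S D` — those moreover injective on `S ∪ D`;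
  `descFactorial_le_card_goodExt` — at least `(g - |S|)(g - |S| - 1)⋯(g - |S| - |D| + 1)` of
  them when `O₀` is injective on `S` (extend one vertex at a time, avoiding used colours).
* `descFactorial_mul_pow_le_of_add_le` — `g(g-1)⋯(g-l+1) · g^d ≤ (g-p)⋯(g-p-d+1) · g^l` for
  `p + d ≤ l` (Alon–Boppana, last display in the proof of Lemma 3.6).
* `card_filter_not_injOn_mul_le` — the **fibre lemma**: inside an event determined by the
  colours off `D` and properly colouring `P` (`P ∩ D = ∅`, `|P| + |D| ≤ l`), the fraction of
  colourings not properly colouring `P ∪ D` is at most `1 - g(g-1)⋯(g-l+1)/g^l` (this is the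
  conditional-independence step of Lemma 3.6, one petal at a time).
* `card_badColorings_mul_le`, `card_badColorings_ofFn_mul_le` — **Lemma 3.6**: if
  `W_i ∩ W_j ⊆ U` for `i ≠ j` and `|W_i| ≤ l`, the number of `g`-colourings of `V` that properly
  colour `U` but none of `W₁, …, W_r` is at most `g^|V| · (1 - g(g-1)⋯(g-l+1)/g^l)^r`, i.e.
  `#bad · (g^l)^r ≤ (g^l - g(g-1)⋯(g-l+1))^r · g^|V|`.

## References

* N. Alon, R. B. Boppana, *The monotone circuit complexity of Boolean functions*,
  Combinatorica 7 (1987) 1–22, Lemma 3.6 [AlonBoppana1987].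
-/

namespace Literature.Computability.Complexity

namespace Razborov

open Finset

variable {V : Type*} [Fintype V] [DecidableEq V] {g : ℕ}

/-! ### Falling factorials -/

/-- `g(g-1)⋯(g-l+1) · g^d ≤ (g-p)(g-p-1)⋯(g-p-d+1) · g^l` for `p + d ≤ l`: the probability that a
random colouring is injective on `l` given vertices is at most the probability that it extends a
given injective colouring of `p` vertices injectively to `d` further vertices (Alon–Boppana
1987, proof of Lemma 3.6, last two inequalities; the splitting
`n(n-1)⋯(n-a-b+1) = n⋯(n-a+1) · (n-a)⋯(n-a-b+1)` is Mathlib's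
`Nat.descFactorial_mul_descFactorial`). [cite: AlonBoppana1987, Lemma 3.6] -/
theorem descFactorial_mul_pow_le_of_add_le {g p d l : ℕ} (h : p + d ≤ l) :
    g.descFactorial l * g ^ d ≤ (g - p).descFactorial d * g ^ l := by
  have hsplit : ∀ a b : ℕ, g.descFactorial (a + b) = g.descFactorial a * (g - a).descFactorial b :=
    fun a b => by
      have h' := Nat.descFactorial_mul_descFactorial (n := g) (Nat.le_add_right a b)
      rw [Nat.add_sub_cancel_left] at h'
      rw [← h', mul_comm]
  obtain ⟨e, rfl⟩ : ∃ e, l = p + d + e := ⟨l - (p + d), by omega⟩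
  rw [hsplit (p + d) e, hsplit p d]
  calc g.descFactorial p * (g - p).descFactorial d * (g - (p + d)).descFactorial e * g ^ d
      ≤ g ^ p * (g - p).descFactorial d * g ^ e * g ^ d := by
        gcongr
        · exact Nat.descFactorial_le_pow _ _
        · exact (Nat.descFactorial_le_pow _ _).trans (Nat.pow_le_pow_left (Nat.sub_le _ _) _)
    _ = (g - p).descFactorial d * g ^ (p + d + e) := by ring

/-! ### Colourings agreeing off a set, and their injective extensions -/

open Classical in
/-- The colourings agreeing with `O₀` outside `D` (the fibre of the restriction map).
[folklore] -/
noncomputable def fiber (O₀ : V → Fin g) (D : Finset V) : Finset (V → Fin g) :=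
  univ.filter fun O => ∀ v, v ∉ D → O v = O₀ v

/-- Membership in `fiber`. [folklore] -/
@[simp] theorem mem_fiber {O₀ O : V → Fin g} {D : Finset V} :
    O ∈ fiber O₀ D ↔ ∀ v, v ∉ D → O v = O₀ v := by
  classical
  simp [fiber]

/-- `O₀` lies in its own fibres. [folklore] -/
theorem self_mem_fiber (O₀ : V → Fin g) (D : Finset V) : O₀ ∈ fiber O₀ D :=
  mem_fiber.2 fun _ _ => rfl

/-- A fibre over `D` has at most `g ^ |D|` colourings. [folklore] -/
theorem card_fiber_le (O₀ : V → Fin g) (D : Finset V) : #(fiber O₀ D) ≤ g ^ #D := by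
  classical
  induction D using Finset.induction_on with
  | empty =>
    rw [card_empty, pow_zero]
    refine card_le_one.2 fun O hO O' hO' => ?_
    rw [mem_fiber] at hO hO'
    funext v
    rw [hO v (notMem_empty v), hO' v (notMem_empty v)]
  | insert v D hv ih =>
    have hsub : fiber O₀ (insert v D) ⊆
        (fiber O₀ D).biUnion fun O => univ.image fun c => Function.update O v c := by
      intro O hO
      rw [mem_fiber] at hO
      refine mem_biUnion.2 ⟨Function.update O v (O₀ v), mem_fiber.2 fun w hw => ?_,
        mem_image.2 ⟨O v, mem_univ _, ?_⟩⟩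
      · by_cases hwv : w = v
        · subst hwv
          simp
        · rw [Function.update_of_ne hwv]
          exact hO w (by simp [hwv, hw])
      · rw [Function.update_idem, Function.update_eq_self]
    calc #(fiber O₀ (insert v D))
        ≤ #((fiber O₀ D).biUnion fun O => univ.image fun c => Function.update O v c) :=
          card_le_card hsub
      _ ≤ #(fiber O₀ D) * g := card_biUnion_le_card_mul _ _ _ fun O _ =>
          card_image_le.trans (by simp)
      _ ≤ g ^ #D * g := Nat.mul_le_mul_right _ ih
      _ = g ^ #(insert v D) := by rw [card_insert_of_notMem hv, pow_succ]

open Classical in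
/-- The colourings agreeing with `O₀` off `D` that are injective on `S ∪ D` (injective extensions
to `D` of the colouring `O₀` of `S`). [folklore] -/
noncomputable def goodExt (O₀ : V → Fin g) (S D : Finset V) : Finset (V → Fin g) :=
  (fiber O₀ D).filter fun O => Set.InjOn O ↑(S ∪ D)

/-- Membership in `goodExt`. [folklore] -/
theorem mem_goodExt {O₀ O : V → Fin g} {S D : Finset V} :
    O ∈ goodExt O₀ S D ↔ (∀ v, v ∉ D → O v = O₀ v) ∧ Set.InjOn O ↑(S ∪ D) := by
  classical
  simp [goodExt]

/-- **Counting injective extensions.** If `O₀` is injective on `S` and `S ∩ D = ∅`, at least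
`(g - |S|)(g - |S| - 1)⋯(g - |S| - |D| + 1)` colourings agree with `O₀` off `D` and are
injective on `S ∪ D` (extend vertex by vertex, each time avoiding the at most `|S| + |D'|`
colours already used; Alon–Boppana 1987, proof of Lemma 3.6:
`Pr[W_i is PC | W is PC] = (g - p_i)⋯(g - p_i - q_i + 1)/g^{q_i}`). [cite: AlonBoppana1987, Lemma 3.6] -/
theorem descFactorial_le_card_goodExt (O₀ : V → Fin g) {S : Finset V} (hS : Set.InjOn O₀ ↑S) :
    ∀ D : Finset V, Disjoint S D → (g - #S).descFactorial #D ≤ #(goodExt O₀ S D) := by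
  classical
  intro D
  induction D using Finset.induction_on with
  | empty =>
    intro _
    rw [card_empty, Nat.descFactorial_zero, Nat.succ_le_iff, card_pos]
    exact ⟨O₀, mem_goodExt.2 ⟨fun _ _ => rfl, by simpa using hS⟩⟩
  | insert v D hv ih =>
    intro hdisj
    have hvS : v ∉ S := fun h => disjoint_left.1 hdisj h (mem_insert_self v D)
    have hdisj' : Disjoint S D := Disjoint.mono_right (subset_insert _ _) hdisj
    have ih' := ih hdisj'
    -- the family of one-vertex extensions of the good extensions to `D`
    set T : Finset (V → Fin g) := (goodExt O₀ S D).biUnion fun O =>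
      (univ \ (S ∪ D).image O).image fun c => Function.update O v c with hT
    have hTsub : T ⊆ goodExt O₀ S (insert v D) := by
      intro O' hO'
      rw [hT, mem_biUnion] at hO'
      obtain ⟨O, hO, hO'⟩ := hO'
      obtain ⟨c, hc, rfl⟩ := mem_image.1 hO'
      rw [mem_sdiff] at hc
      obtain ⟨hOfib, hOinj⟩ := mem_goodExt.1 hO
      refine mem_goodExt.2 ⟨fun w hw => ?_, ?_⟩
      · have hwv : w ≠ v := fun h => hw (h ▸ mem_insert_self v D)
        rw [Function.update_of_ne hwv]
        exact hOfib w fun h => hw (mem_insert_of_mem h)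
      · intro a ha b hb hab
        simp only [coe_union, coe_insert, Set.mem_union, Set.mem_insert_iff, mem_coe] at ha hb
        have hnot : ∀ w, w ∈ S ∨ w ∈ D → Function.update O v c w ≠ c := by
          intro w hw h
          have hwv : w ≠ v := by
            rintro rfl
            rcases hw with hw | hw
            · exact hvS hw
            · exact hv hw
          rw [Function.update_of_ne hwv] at h
          exact hc.2 (mem_image.2 ⟨w, by simpa [mem_union] using hw, h⟩)
        by_cases hav : a = v
        · by_cases hbv : b = v
          · rw [hav, hbv]
          · subst hav
            have hb' : b ∈ S ∨ b ∈ D := by tauto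
            rw [Function.update_self] at hab
            exact absurd hab.symm (hnot b hb')
        · by_cases hbv : b = v
          · subst hbv
            have ha' : a ∈ S ∨ a ∈ D := by tauto
            rw [Function.update_self] at hab
            exact absurd hab (hnot a ha')
          · have ha' : a ∈ S ∨ a ∈ D := by tauto
            have hb' : b ∈ S ∨ b ∈ D := by tauto
            rw [Function.update_of_ne hav, Function.update_of_ne hbv] at hab
            exact hOinj (by simpa [mem_union] using ha') (by simpa [mem_union] using hb') hab
    have hTcard : #T = ∑ O ∈ goodExt O₀ S D,
        #((univ \ (S ∪ D).image O).image fun c => Function.update O v c) := by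
      rw [hT, card_biUnion]
      intro O₁ hO₁ O₂ hO₂ hne
      rw [Function.onFun, disjoint_left]
      intro O' h1 h2
      obtain ⟨c₁, -, rfl⟩ := mem_image.1 h1
      obtain ⟨c₂, -, h⟩ := mem_image.1 h2
      apply hne
      funext w
      by_cases hwv : w = v
      · subst hwv
        rw [(mem_goodExt.1 (mem_coe.1 hO₁)).1 w hv, (mem_goodExt.1 (mem_coe.1 hO₂)).1 w hv]
      · have := congrFun h w
        rwa [Function.update_of_ne hwv, Function.update_of_ne hwv, eq_comm] at this
    have hterm : ∀ O ∈ goodExt O₀ S D,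
        g - #S - #D ≤ #((univ \ (S ∪ D).image O).image fun c => Function.update O v c) := by
      intro O _
      rw [card_image_of_injective _ (Function.update_injective O v), card_univ_sdiff,
        Fintype.card_fin, Nat.sub_sub]
      exact Nat.sub_le_sub_left (card_image_le.trans (card_union_le _ _)) _
    calc (g - #S).descFactorial #(insert v D)
        = (g - #S - #D) * (g - #S).descFactorial #D := by
          rw [card_insert_of_notMem hv, Nat.descFactorial_succ]
      _ ≤ (g - #S - #D) * #(goodExt O₀ S D) := Nat.mul_le_mul_left _ ih'
      _ = ∑ O ∈ goodExt O₀ S D, (g - #S - #D) := by rw [sum_const, smul_eq_mul, mul_comm]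
      _ ≤ ∑ O ∈ goodExt O₀ S D,
            #((univ \ (S ∪ D).image O).image fun c => Function.update O v c) :=
          sum_le_sum hterm
      _ = #T := hTcard.symm
      _ ≤ #(goodExt O₀ S (insert v D)) := card_le_card hTsub

/-! ### The fibre lemma -/

open Classical in
/-- **One petal.** Inside a fibre over `D` of a colouring `O₀` injective on `P` (`P ∩ D = ∅`,
`|P| + |D| ≤ l`), the colourings not injective on `P ∪ D` are at most a fraction
`1 - g(g-1)⋯(g-l+1)/g^l` of the fibre (Alon–Boppana 1987, proof of Lemma 3.6:
`Pr[W_i not PC | W PC] ≤ 1 - g(g-1)⋯(g-l+1)/g^l`). [cite: AlonBoppana1987, Lemma 3.6] -/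
theorem card_fiber_filter_not_injOn_mul_le {l : ℕ} {P D : Finset V} (hPD : Disjoint P D)
    (hl : #P + #D ≤ l) (O₀ : V → Fin g) (hO₀ : Set.InjOn O₀ ↑P) :
    #((fiber O₀ D).filter fun O => ¬ Set.InjOn O ↑(P ∪ D)) * g ^ l ≤
      (g ^ l - g.descFactorial l) * #(fiber O₀ D) := by
  classical
  set A := #(fiber O₀ D) with hA
  set B := #(goodExt O₀ P D) with hB
  have hsplit : #((fiber O₀ D).filter fun O => ¬ Set.InjOn O ↑(P ∪ D)) = A - B := by
    have h := card_filter_add_card_filter_not (s := fiber O₀ D) (fun O => Set.InjOn O ↑(P ∪ D))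
    have hB' : B = #((fiber O₀ D).filter fun O => Set.InjOn O ↑(P ∪ D)) := by rw [hB, goodExt]
    omega
  have hAle : A ≤ g ^ #D := card_fiber_le O₀ D
  have hBge : (g - #P).descFactorial #D ≤ B := descFactorial_le_card_goodExt O₀ hO₀ D hPD
  have hkey : A * g.descFactorial l ≤ B * g ^ l :=
    calc A * g.descFactorial l ≤ g ^ #D * g.descFactorial l := Nat.mul_le_mul_right _ hAle
      _ = g.descFactorial l * g ^ #D := mul_comm _ _
      _ ≤ (g - #P).descFactorial #D * g ^ l := descFactorial_mul_pow_le_of_add_le hl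
      _ ≤ B * g ^ l := Nat.mul_le_mul_right _ hBge
  rw [hsplit, Nat.sub_mul, Nat.sub_mul, mul_comm (g ^ l) A, mul_comm (g.descFactorial l) A]
  exact Nat.sub_le_sub_left hkey _

open Classical in
/-- **The fibre lemma** (conditional-independence step of Alon–Boppana 1987, Lemma 3.6): let
`E` be a set of colourings determined by the colours off `D` (closed under changing colours on
`D`), all injective on `P`, where `P ∩ D = ∅` and `|P| + |D| ≤ l`. Then
`#{O ∈ E : O not injective on P ∪ D} · g^l ≤ (g^l - g(g-1)⋯(g-l+1)) · #E`.
[cite: AlonBoppana1987, Lemma 3.6] -/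
theorem card_filter_not_injOn_mul_le {l : ℕ} {P D : Finset V} (hPD : Disjoint P D)
    (hl : #P + #D ≤ l) {E : Finset (V → Fin g)}
    (hE : ∀ O ∈ E, ∀ O' : V → Fin g, (∀ v, v ∉ D → O' v = O v) → O' ∈ E)
    (hEP : ∀ O ∈ E, Set.InjOn O ↑P) :
    #(E.filter fun O => ¬ Set.InjOn O ↑(P ∪ D)) * g ^ l ≤ (g ^ l - g.descFactorial l) * #E := by
  classical
  -- the restriction of a colouring to the complement of `D`
  let key : (V → Fin g) → (V → Option (Fin g)) := fun O v => if v ∈ D then none else some (O v)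
  have hkey : ∀ O O' : V → Fin g, key O = key O' ↔ ∀ v, v ∉ D → O v = O' v := by
    intro O O'
    constructor
    · intro h v hv
      have := congrFun h v
      simpa [key, hv] using this
    · intro h
      funext v
      by_cases hv : v ∈ D
      · simp [key, hv]
      · simp [key, hv, h v hv]
  have hfib : ∀ O₀ ∈ E, (E.filter fun O => key O = key O₀) = fiber O₀ D := by
    intro O₀ hO₀
    ext O
    simp only [mem_filter, mem_fiber]
    constructor
    · rintro ⟨-, h⟩
      exact (hkey O O₀).1 h
    · intro h
      exact ⟨hE O₀ hO₀ O h, (hkey O O₀).2 h⟩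
  have hfib' : ∀ O₀ ∈ E, ((E.filter fun O => ¬ Set.InjOn O ↑(P ∪ D)).filter
      fun O => key O = key O₀) = (fiber O₀ D).filter fun O => ¬ Set.InjOn O ↑(P ∪ D) := by
    intro O₀ hO₀
    rw [filter_filter, ← hfib O₀ hO₀, filter_filter]
    exact filter_congr fun O _ => and_comm
  have hmaps : ∀ (F : Finset (V → Fin g)), F ⊆ E → (F : Set (V → Fin g)).MapsTo key (E.image key) :=
    fun F hF O hO => mem_coe.2 (mem_image_of_mem key (hF hO))
  rw [card_eq_sum_card_fiberwise (hmaps _ (filter_subset _ _)),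
    card_eq_sum_card_fiberwise (hmaps E Subset.rfl), sum_mul, mul_sum]
  refine sum_le_sum fun κ hκ => ?_
  obtain ⟨O₀, hO₀, rfl⟩ := mem_image.1 hκ
  rw [hfib' O₀ hO₀, hfib O₀ hO₀]
  exact card_fiber_filter_not_injOn_mul_le hPD hl O₀ (hEP O₀ hO₀)

/-! ### Lemma 3.6 -/

open Classical in
/-- The colourings that properly colour `U` but none of the sets in the list `Ws` (the event of
Alon–Boppana 1987, Lemma 3.6). [cite: AlonBoppana1987, Lemma 3.6] -/
noncomputable def badColorings (g : ℕ) (U : Finset V) (Ws : List (Finset V)) : Finset (V → Fin g) :=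
  univ.filter fun O => Set.InjOn O ↑U ∧ ∀ W ∈ Ws, ¬ Set.InjOn O ↑W

/-- Membership in `badColorings`. [folklore] -/
@[simp] theorem mem_badColorings {U : Finset V} {Ws : List (Finset V)} {O : V → Fin g} :
    O ∈ badColorings g U Ws ↔ Set.InjOn O ↑U ∧ ∀ W ∈ Ws, ¬ Set.InjOn O ↑W := by
  classical
  simp [badColorings]

/-- **Alon–Boppana, Lemma 3.6** (list form). If the sets of `Ws` pairwise intersect inside `U`
and have at most `l` elements each, then the number of `g`-colourings properly colouring `U` but
no member of `Ws` satisfies `#bad · (g^l)^|Ws| ≤ (g^l - g(g-1)⋯(g-l+1))^|Ws| · g^|V|`, i.e.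
`Pr[U is PC and no W ∈ Ws is PC] ≤ (1 - g(g-1)⋯(g-l+1)/g^l)^|Ws|`. (Induction on the list:
the event for the tail is determined off `W ∖ U`, and the fibre lemma peels off `W`.)
[cite: AlonBoppana1987, Lemma 3.6] -/
theorem card_badColorings_mul_le {l : ℕ} (U : Finset V) :
    ∀ Ws : List (Finset V), Ws.Pairwise (fun A B => A ∩ B ⊆ U) → (∀ W ∈ Ws, #W ≤ l) →
      #(badColorings g U Ws) * (g ^ l) ^ Ws.length ≤
        (g ^ l - g.descFactorial l) ^ Ws.length * g ^ Fintype.card V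
  | [], _, _ => by
    classical
    rw [List.length_nil, pow_zero, pow_zero, mul_one, one_mul, ← Fintype.card_fin g,
      ← Fintype.card_fun, Fintype.card_fin, ← card_univ]
    exact card_le_card (filter_subset _ _)
  | W :: Ws, hpw, hl => by
    classical
    rw [List.pairwise_cons] at hpw
    have ih := card_badColorings_mul_le U Ws hpw.2 fun W' h => hl W' (List.mem_cons_of_mem W h)
    have hWl : #W ≤ l := hl W List.mem_cons_self
    -- peel off `W = (W ∩ U) ∪ (W \ U)`
    have hstep : #(badColorings g U (W :: Ws)) * g ^ l ≤
        (g ^ l - g.descFactorial l) * #(badColorings g U Ws) := by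
      have hPD : Disjoint (W ∩ U) (W \ U) :=
        disjoint_left.2 fun x hx hx' => (mem_sdiff.1 hx').2 (mem_inter.1 hx).2
      have hcard : #(W ∩ U) + #(W \ U) ≤ l := by
        rw [add_comm, card_sdiff_add_card_inter]; exact hWl
      have hE : ∀ O ∈ badColorings g U Ws, ∀ O' : V → Fin g,
          (∀ v, v ∉ W \ U → O' v = O v) → O' ∈ badColorings g U Ws := by
        intro O hO O' hO'
        rw [mem_badColorings] at hO ⊢
        have hU : Set.EqOn O' O ↑U := fun v hv => hO' v fun h => (mem_sdiff.1 h).2 hv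
        refine ⟨hU.injOn_iff.2 hO.1, fun W' hW' hinj => hO.2 W' hW' ?_⟩
        have hW'eq : Set.EqOn O' O ↑W' := fun v hv => hO' v fun h =>
          (mem_sdiff.1 h).2 (hpw.1 W' hW' (mem_inter.2 ⟨(mem_sdiff.1 h).1, hv⟩))
        exact hW'eq.injOn_iff.1 hinj
      have hEP : ∀ O ∈ badColorings g U Ws, Set.InjOn O ↑(W ∩ U) := fun O hO =>
        (mem_badColorings.1 hO).1.mono (by simp)
      have h := card_filter_not_injOn_mul_le hPD hcard hE hEP
      have hWU : W ∩ U ∪ W \ U = W := by rw [union_comm, sdiff_union_inter]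
      have heq : badColorings g U (W :: Ws) =
          (badColorings g U Ws).filter fun O => ¬ Set.InjOn O ↑(W ∩ U ∪ W \ U) := by
        ext O
        simp only [mem_badColorings, mem_filter, List.mem_cons, forall_eq_or_imp, hWU]
        tauto
      rwa [heq]
    calc #(badColorings g U (W :: Ws)) * (g ^ l) ^ (W :: Ws).length
        = (#(badColorings g U (W :: Ws)) * g ^ l) * (g ^ l) ^ Ws.length := by
          rw [List.length_cons, pow_succ]; ring
      _ ≤ ((g ^ l - g.descFactorial l) * #(badColorings g U Ws)) * (g ^ l) ^ Ws.length :=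
          Nat.mul_le_mul_right _ hstep
      _ = (g ^ l - g.descFactorial l) * (#(badColorings g U Ws) * (g ^ l) ^ Ws.length) := by ring
      _ ≤ (g ^ l - g.descFactorial l) *
            ((g ^ l - g.descFactorial l) ^ Ws.length * g ^ Fintype.card V) :=
          Nat.mul_le_mul_left _ ih
      _ = (g ^ l - g.descFactorial l) ^ (W :: Ws).length * g ^ Fintype.card V := by
          rw [List.length_cons, pow_succ]; ring

/-- **Alon–Boppana, Lemma 3.6** (indexed form): if `W_i ∩ W_j ⊆ U` for all `i ≠ j` and
`|W_i| ≤ l` for all `i < r`, then the number of `g`-colourings of `V` that properly colour `U`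
but none of the `W_i` satisfies `#bad · (g^l)^r ≤ (g^l - g(g-1)⋯(g-l+1))^r · g^|V|`.
[cite: AlonBoppana1987, Lemma 3.6] -/
theorem card_badColorings_ofFn_mul_le {r l : ℕ} (U : Finset V) (W : Fin r → Finset V)
    (hW : ∀ i j, i ≠ j → W i ∩ W j ⊆ U) (hl : ∀ i, #(W i) ≤ l) :
    #(badColorings g U (List.ofFn W)) * (g ^ l) ^ r ≤
      (g ^ l - g.descFactorial l) ^ r * g ^ Fintype.card V := by
  have h := card_badColorings_mul_le (g := g) U (List.ofFn W)
    (List.pairwise_ofFn.2 fun i j hij => hW i j (Fin.ne_of_lt hij))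
    (List.forall_mem_ofFn_iff.2 hl)
  rwa [List.length_ofFn] at h

end Razborov

end Literature.Computability.Complexity
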